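import Literature.NumberTheory.EllipticCurves.BSDSelmer
import Literature.NumberTheory.EllipticCurves.BSDRootNumber
import HarnessLib

/-!
# bsd.S19: the named fact `p_parity` unfolded to the tree's primitives

`Literature.NumberTheory.EllipticCurves.p_parity W p` (`BSDSelmer.lean`) is the `p`-parity theorem
of T. Dokchitser and V. Dokchitser, *On the Birch–Swinnerton-Dyer quotients modulo squares*, Ann. of
Math. 172 (2010), 567–596, in the wording of their Thm. 1.4 — "Conjecture 1.2 [`rk_p(E/K)` is even
if and only if `w(E/K) = 1`] holds for all `E/ℚ` and all primes `p`" (§1; p. 2 of the held author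
version; Thm. 4.19 "(=Theorem 1.4)", §4.6, p. 26 there, is the displayed congruence
`rk_p(E/ℚ) ≡ ord_{s=1} L(E, s) (mod 2)`, the tree's `selmerCorank_mod_two_eq`). The Lean body is
`(-1) ^ W.selmerCorank p = W.rootNumber` with
`rk_p = corank_{ℤ_p} Sel_{p^∞}(E/ℚ) = W.selmerCorank p` and `w(E/ℚ) = W.rootNumber`, the *analytic*
root number of `RootNumber.lean`: `-1` if the completed `L`-function of level `N_E` admits an
entire continuation with `Λ(2 - s) = -Λ(s)` (`W.HasFunctionalEquationSign (-1)`), and `1`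
otherwise.

This file records, as proved theorems and without touching any statement, exactly what the fact
asserts in those primitives — the "exact hypotheses" reading requested (hub unit
`libB-BSDpParity-75`) for the route items that carry
`hpar : ∀ W [W.IsElliptic] p [Fact p.Prime], p_parity W p` (53 at the carrier census of 2026-08-17):

* `p_parity_iff_even_selmerCorank_iff` — `p_parity W p ↔ (Even rk_p ↔ w = 1)`, Conjecture 1.2
  verbatim; `p_parity_iff_rootNumber_eq_one_of_even`, `p_parity_iff_rootNumber_eq_neg_one_of_odd`;
* `p_parity_iff_not_hasFunctionalEquationSign_of_even`,
  `p_parity_iff_hasFunctionalEquationSign_of_odd` — at a curve of even `p^∞`-Selmer corank the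
  fact says that NO entire continuation of `Λ(E, s)` with sign `-1` exists; at a curve of odd corank
  it says that one DOES exist. In particular (`hasFunctionalEquationSign_neg_one_of_p_parity`,
  `exists_continuation_of_p_parity_of_odd`) any discharge `p_parity_holds` contains the analytic
  continuation and functional equation of `L(E, s)` for every `E/ℚ` of odd `p^∞`-Selmer corank —
  the Hasse–Weil conjecture for those curves (Deuring for CM curves; in general known only through
  the Modularity Theorem, Wiles 1995 / Breuil–Conrad–Diamond–Taylor 2001) — while at even corank
  it is implied by the mere absence of a continuation
  (`p_parity_of_completedLContinuations_eq_empty_of_even`, the junk branch of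
  `WeierstrassCurve.rootNumber`, which modularity rules out but Lean does not know) and, granted
  the functional equation and the uniqueness of its sign, reads `Λ(2 - s) = +Λ(s)`
  (`p_parity_iff_hasFunctionalEquationSign_one_of_even`);
* `even_selmerCorank_iff_of_p_parity`, `selmerCorank_mod_two_eq_selmerCorank_mod_two_of_p_parity`
  — the parity of `rk_p(E/ℚ)` is independent of `p` (immediate from Thm. 1.4, both parities being
  that of `w(E)`); and the same three consequences in the dependents' hypothesis shape
  (`…_of_forall_p_parity`).

## Why `p_parity_holds` is not here (status 2026-08-17)

The tree already reduces `p_parity` to its printed inputs twice, by proved theorems: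
`hpar_of_nekovar` (`BSDSelmerCMPConverseKLevelProofs`, Part 8: the named facts
`Nekovar2013_theoremA` and `ModularForms.exists_isNewformOf`) and
`p_parity_of_facts_of_exists_isNewformOf` (`BSDSelmerPParityProofs`: modularity, Monsky 1996,
Waldspurger / Murty–Murty, Gross–Zagier–Kolyvagin, the Selmer rank of a quadratic base change and
the authors' §4.6 theorem over the Heegner field). None of these leaves is discharged, and by the
theorems below the analytic one cannot be bypassed: the fact is reduced, not weakened, and a
discharge is at least as strong as the analytic continuation and functional equation of `L(E, s)`
for every `E/ℚ` of odd `p^∞`-Selmer corank.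

## References

* [DokchitserDokchitserAnnals2010] T. Dokchitser, V. Dokchitser, Ann. of Math. 172 (2010),
  567–596 = arXiv:math/0610290: Conj. 1.2 and Thm. 1.4 (§1), Thm. 4.19 (§4.6) — held
  (`paper:dokchitser2010-birch-swinnerton-dyer-quotients-modulo-squares`, pp. 2 and 26 of that
  file).
* [SilvermanAEC2009] J. H. Silverman, *The Arithmetic of Elliptic Curves*, 2nd ed. (2009), C.16,
  Thm. 16.3 and the sentence after it (p. 451): the sign of the functional equation.
* [BCDTJAMS2001] C. Breuil, B. Conrad, F. Diamond, R. Taylor, J. Amer. Math. Soc. 14 (2001), Thm. A.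
-/

noncomputable section

open WeierstrassCurve

namespace Literature.NumberTheory.EllipticCurves

/-! ### The root number unfolded -/

section RootNumber

variable (W : WeierstrassCurve ℚ)

/-- `w(E) = 1` iff the completed `L`-function admits NO entire continuation with functional
equation of sign `-1` (the `else` branch of the analytic definition `WeierstrassCurve.rootNumber`;
companion of `rootNumber_eq_neg_one_iff`). For an elliptic `W` this is the case "sign `+1`" of
Silverman AEC C.16, Thm. 16.3, by uniqueness of the sign; without a continuation it is the
documented junk value. [cite: SilvermanAEC2009, C.16 Thm. 16.3 (p. 451)] -/
theorem rootNumber_eq_one_iff_not_hasFunctionalEquationSign :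
    W.rootNumber = 1 ↔ ¬ W.HasFunctionalEquationSign (-1) := by
  rw [rootNumber_eq_sign_functional_equation]
  split_ifs with h <;> simp [h]

end RootNumber

/-! ### `p_parity W p` unfolded -/

section Unfolding

variable (W : WeierstrassCurve ℚ) (p : ℕ)

/-- **`p_parity W p` is Conjecture 1.2 of Dokchitser–Dokchitser for `E/ℚ` verbatim**:
`(-1)^{rk_p} = w(E)` iff (`rk_p(E/ℚ)` is even iff `w(E/ℚ) = 1`), since `w(E) ∈ {±1}`
(`WeierstrassCurve.rootNumber_eq_one_or`).
[cite: DokchitserDokchitserAnnals2010, Conj. 1.2 and Thm. 1.4 (§1)] -/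
theorem p_parity_iff_even_selmerCorank_iff :
    p_parity W p ↔ (Even (W.selmerCorank p) ↔ W.rootNumber = 1) := by
  have hne : (-1 : ℤ) ≠ 1 := by decide
  unfold p_parity
  rcases (W.selmerCorank p).even_or_odd with he | ho
  · rw [he.neg_one_pow]
    exact ⟨fun h ↦ ⟨fun _ ↦ h.symm, fun _ ↦ he⟩, fun h ↦ (h.mp he).symm⟩
  · rw [ho.neg_one_pow]
    constructor
    · intro h
      exact ⟨fun he' ↦ absurd he' (Nat.not_even_iff_odd.mpr ho), fun h1 ↦ absurd (h.trans h1) hne⟩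
    · intro h
      rcases W.rootNumber_eq_one_or with h1 | h1
      · exact absurd (h.mpr h1) (Nat.not_even_iff_odd.mpr ho)
      · exact h1.symm

/-- At a curve of EVEN `p^∞`-Selmer corank, `p_parity W p` says `w(E) = 1`.
[cite: DokchitserDokchitserAnnals2010, Conj. 1.2 and Thm. 1.4 (§1)] -/
theorem p_parity_iff_rootNumber_eq_one_of_even (he : Even (W.selmerCorank p)) :
    p_parity W p ↔ W.rootNumber = 1 := by
  unfold p_parity
  rw [he.neg_one_pow]
  exact eq_comm

/-- At a curve of ODD `p^∞`-Selmer corank, `p_parity W p` says `w(E) = -1`.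
[cite: DokchitserDokchitserAnnals2010, Conj. 1.2 and Thm. 1.4 (§1)] -/
theorem p_parity_iff_rootNumber_eq_neg_one_of_odd (ho : Odd (W.selmerCorank p)) :
    p_parity W p ↔ W.rootNumber = -1 := by
  unfold p_parity
  rw [ho.neg_one_pow]
  exact eq_comm

/-- **Even corank, in primitives.** If `corank_{ℤ_p} Sel_{p^∞}(E/ℚ)` is even, `p_parity W p` holds
iff the completed `L`-function of `E` admits no entire continuation with `Λ(2 - s) = -Λ(s)`.
[cite: DokchitserDokchitserAnnals2010, Thm. 1.4 (§1)] -/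
theorem p_parity_iff_not_hasFunctionalEquationSign_of_even (he : Even (W.selmerCorank p)) :
    p_parity W p ↔ ¬ W.HasFunctionalEquationSign (-1) :=
  (p_parity_iff_rootNumber_eq_one_of_even W p he).trans
    (rootNumber_eq_one_iff_not_hasFunctionalEquationSign W)

/-- **Odd corank, in primitives.** If `corank_{ℤ_p} Sel_{p^∞}(E/ℚ)` is odd, `p_parity W p` holds
iff the completed `L`-function of `E` (level `N_E`) admits an entire continuation with
`Λ(2 - s) = -Λ(s)`. [cite: DokchitserDokchitserAnnals2010, Thm. 1.4 (§1)] -/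
theorem p_parity_iff_hasFunctionalEquationSign_of_odd (ho : Odd (W.selmerCorank p)) :
    p_parity W p ↔ W.HasFunctionalEquationSign (-1) :=
  (p_parity_iff_rootNumber_eq_neg_one_of_odd W p ho).trans (rootNumber_eq_neg_one_iff W)

/-- **Even corank, modulo the functional equation.** Granted the functional equation with sign
`w(E)` (`W.hasFunctionalEquationSign_rootNumber`, Silverman AEC C.16, Thm. 16.3, via modularity)
and the uniqueness of the sign (`W.hasFunctionalEquationSign_unique`, `Λ(E, ·) ≢ 0`), at even
corank `p_parity W p` says that `Λ(E, s)` satisfies `Λ(2 - s) = +Λ(s)` — the non-junk reading of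
the even case. [cite: DokchitserDokchitserAnnals2010, Thm. 1.4 (§1)] -/
theorem p_parity_iff_hasFunctionalEquationSign_one_of_even [W.IsElliptic]
    (hfe : W.hasFunctionalEquationSign_rootNumber) (huniq : W.hasFunctionalEquationSign_unique)
    (he : Even (W.selmerCorank p)) : p_parity W p ↔ W.HasFunctionalEquationSign 1 := by
  rw [p_parity_iff_rootNumber_eq_one_of_even W p he]
  constructor
  · intro h1
    have h : W.HasFunctionalEquationSign W.rootNumber := hfe
    rwa [h1] at h
  · intro h1
    rcases W.rootNumber_eq_one_or with h | h
    · exact h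
    · exact absurd (huniq h1 ((rootNumber_eq_neg_one_iff W).mp h)) (by decide)

/-! ### What a discharge contains -/

/-- **`p_parity` carries the functional equation at odd corank**: from `p_parity W p` and
`rk_p(E/ℚ)` odd, the completed `L`-function of `E` has an entire continuation with sign `-1`
(Hasse–Weil for `E`, with the sign; for non-CM `E` known only via modularity, Wiles 1995 /
Breuil–Conrad–Diamond–Taylor 2001, Thm. A).
[cite: DokchitserDokchitserAnnals2010, Thm. 1.4 (§1)] -/
theorem hasFunctionalEquationSign_neg_one_of_p_parity (h : p_parity W p)
    (ho : Odd (W.selmerCorank p)) : W.HasFunctionalEquationSign (-1) :=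
  (p_parity_iff_hasFunctionalEquationSign_of_odd W p ho).mp h

/-- The same, fully unfolded: from `p_parity W p` at odd corank, there is an entire `Λ : ℂ → ℂ`
agreeing with `N_E^{s/2} (2π)^{-s} Γ(s) L(E, s)` on `Re s > 3/2` and satisfying
`Λ(2 - s) = -Λ(s)` for all `s`. [cite: DokchitserDokchitserAnnals2010, Thm. 1.4 (§1)] -/
theorem exists_continuation_of_p_parity_of_odd (h : p_parity W p) (ho : Odd (W.selmerCorank p)) :
    ∃ Λ : ℂ → ℂ, Differentiable ℂ Λ ∧
      (∀ s : ℂ, (3 / 2 : ℝ) < s.re → Λ s = W.completedLFunction (W.conductorNorm ℤ) s) ∧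
        ∀ s : ℂ, Λ (2 - s) = -Λ s := by
  obtain ⟨Λ, ⟨hd, hagree⟩, hfe⟩ := hasFunctionalEquationSign_neg_one_of_p_parity W p h ho
  refine ⟨Λ, hd, hagree, fun s ↦ ?_⟩
  rw [hfe s]
  push_cast
  ring

/-- In particular the set of entire continuations of `Λ(E, s)` at level `N_E` is nonempty for
every curve of odd `p^∞`-Selmer corank satisfying `p_parity W p`.
[cite: DokchitserDokchitserAnnals2010, Thm. 1.4 (§1)] -/
theorem nonempty_completedLContinuations_of_p_parity_of_odd (h : p_parity W p)
    (ho : Odd (W.selmerCorank p)) : (W.completedLContinuations (W.conductorNorm ℤ)).Nonempty := by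
  obtain ⟨Λ, hΛ, _⟩ := hasFunctionalEquationSign_neg_one_of_p_parity W p h ho
  exact ⟨Λ, hΛ⟩

/-- **`p_parity` forbids the sign `-1` at even corank**: from `p_parity W p` and `rk_p(E/ℚ)` even,
no entire continuation of `Λ(E, s)` with `Λ(2 - s) = -Λ(s)` exists.
[cite: DokchitserDokchitserAnnals2010, Thm. 1.4 (§1)] -/
theorem not_hasFunctionalEquationSign_neg_one_of_p_parity (h : p_parity W p)
    (he : Even (W.selmerCorank p)) : ¬ W.HasFunctionalEquationSign (-1) :=
  (p_parity_iff_not_hasFunctionalEquationSign_of_even W p he).mp h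

/-- **The junk branch, recorded.** At even corank `p_parity W p` is implied by the absence of ANY
entire continuation of the completed `L`-function (then `w(E)` is the documented default `1` of
`WeierstrassCurve.rootNumber`). For an elliptic `W` this premise is false by the Modularity Theorem
(tree fact `WeierstrassCurve.nonempty_completedLContinuations`), but it is not refutable in the
tree today; recorded for audits of the dependents of `p_parity`. [folklore] -/
theorem p_parity_of_completedLContinuations_eq_empty_of_even
    (h0 : W.completedLContinuations (W.conductorNorm ℤ) = ∅) (he : Even (W.selmerCorank p)) :
    p_parity W p := by
  refine (p_parity_iff_not_hasFunctionalEquationSign_of_even W p he).mpr ?_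
  rintro ⟨Λ, hΛ, -⟩
  rw [h0] at hΛ
  exact hΛ

/-! ### Independence of `p` -/

variable {p} {q : ℕ}

/-- **The parity of `rk_p(E/ℚ)` does not depend on `p`** (immediate from Thm. 1.4: both parities
are that of `w(E)`): `p_parity W p` and `p_parity W q` give `Even rk_p ↔ Even rk_q`.
[cite: DokchitserDokchitserAnnals2010, Thm. 1.4 (§1)] -/
theorem even_selmerCorank_iff_of_p_parity (hp : p_parity W p) (hq : p_parity W q) :
    Even (W.selmerCorank p) ↔ Even (W.selmerCorank q) :=
  ((p_parity_iff_even_selmerCorank_iff W p).mp hp).trans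
    ((p_parity_iff_even_selmerCorank_iff W q).mp hq).symm

/-- `% 2` form of `even_selmerCorank_iff_of_p_parity`: `rk_p(E/ℚ) ≡ rk_q(E/ℚ) (mod 2)`.
[cite: DokchitserDokchitserAnnals2010, Thm. 1.4 (§1)] -/
theorem selmerCorank_mod_two_eq_selmerCorank_mod_two_of_p_parity (hp : p_parity W p)
    (hq : p_parity W q) : W.selmerCorank p % 2 = W.selmerCorank q % 2 := by
  have h := even_selmerCorank_iff_of_p_parity W hp hq
  rw [Nat.even_iff, Nat.even_iff] at h
  omega

end Unfolding

/-! ### In the dependents' hypothesis shape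

The 53 route items over `p_parity` (census 2026-08-17) take
`hpar : ∀ (W : WeierstrassCurve ℚ) [W.IsElliptic] (p : ℕ) [Fact p.Prime], p_parity W p`. -/

section Dependents

variable (hpar : ∀ (W : WeierstrassCurve ℚ) [W.IsElliptic] (p : ℕ) [Fact p.Prime], p_parity W p)
  (W : WeierstrassCurve ℚ) [W.IsElliptic]

include hpar

/-- Under `hpar`, `w(E) = 1 ↔ rk_p(E/ℚ)` even, for every elliptic `E/ℚ` and prime `p`
(Conjecture 1.2 as used by the dependents). [cite: DokchitserDokchitserAnnals2010, Thm. 1.4 (§1)] -/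
theorem rootNumber_eq_one_iff_even_selmerCorank_of_forall_p_parity (p : ℕ) [Fact p.Prime] :
    W.rootNumber = 1 ↔ Even (W.selmerCorank p) :=
  ((p_parity_iff_even_selmerCorank_iff W p).mp (hpar W p)).symm

/-- Under `hpar`, every elliptic `E/ℚ` with odd `p^∞`-Selmer corank at some prime `p` has an
entire completed `L`-function with functional equation of sign `-1`: the analytic content any
discharge `p_parity_holds` must supply. [cite: DokchitserDokchitserAnnals2010, Thm. 1.4 (§1)] -/
theorem hasFunctionalEquationSign_neg_one_of_forall_p_parity (p : ℕ) [Fact p.Prime]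
    (ho : Odd (W.selmerCorank p)) : W.HasFunctionalEquationSign (-1) :=
  hasFunctionalEquationSign_neg_one_of_p_parity W p (hpar W p) ho

/-- Under `hpar`, `rk_p(E/ℚ) ≡ rk_q(E/ℚ) (mod 2)` for all primes `p, q` and every elliptic `E/ℚ`.
[cite: DokchitserDokchitserAnnals2010, Thm. 1.4 (§1)] -/
theorem selmerCorank_mod_two_eq_of_forall_p_parity (p q : ℕ) [Fact p.Prime] [Fact q.Prime] :
    W.selmerCorank p % 2 = W.selmerCorank q % 2 :=
  selmerCorank_mod_two_eq_selmerCorank_mod_two_of_p_parity W (hpar W p) (hpar W q)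

end Dependents

end Literature.NumberTheory.EllipticCurves

end
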